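/-
Copyright (c) 2026 the pub-hodgecm-mathlib formalisation cell (harness21).  Prover seat hodgecm-mathlib-K2E3-p12 (g2), Track B «K2-LIT» ∕ h413
(`stmt-HodgeConjecture-24833`), line `K2_E3_EllipticInputs`, unit U12-d «Harish-Chandra characters near a semisimple point»: the identity case (12-Id) of socket
U12-d IS EQUIVALENT to its LIE-ALGEBRA FORM (12-Lie) «`(Π_w |disc χ_Y|_w)^{1∕4}·|Θ_π(c(Y))|` bounded for small skew `Y`» — both directions, every `N`.  2026-09-04.
-/
import Summits.HodgeConjecture.HodgeConjecture.Theorems.K2E3NormalizedCharBddNearCentral                 -- ★ p855303 (K2E3-p12 g0): `normalizedCharBddNear_central_of_lieBound'` (+ ★ p855282: `continuous_detFactor`, `detFactor_zero`, `unitModulusChar_mul_detFactor_eq`)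
import Summits.HodgeConjecture.HodgeConjecture.Theorems.K2E3NormalizedCharBddOnCayleySliceTrivialCases    -- ★ K2E1b-p01: `exists_nhds_zero_slice_subset`; ★ p855019: `exists_unit_rel_iff_isRegularElt`, `isRegularElt_iff_isUnit_discr`
import HarnessLib

/-!
# K2_E3 road (h413 = stmt-HodgeConjecture-24833), unit U12-d — (12-Id) «`|D_G|^{1∕2} Θ_π` BOUNDED NEAR THE IDENTITY» ⟺ (12-Lie) «`|disc χ_Y|^{1∕4} Θ_π(c(Y))`
# BOUNDED FOR SMALL SKEW `Y`» (the form Harish-Chandra's Lie-algebra theorems deliver)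

Cell `pub/hodgecm-mathlib` (D-0151), Track B (21-frontier RULING «PUSH BOTH» 2026-09-03, director req624), seat K2E3-p12 (g2), line lead of row 12 (12-S).
`--supports stmt-HodgeConjecture-24833 --as helper`; THEOREMS ONLY (no definition ∕ instance ∕ notation ∕ named fact ∕ `sorry`); never imports `Cruxes/…/Lines`.

The proposed sub-socket (12-Id) `sig_K2E3NormalizedCharBddNearIdentity` (SUBSIGS-U12d-IdentityDescent v1; composition ★ p855952) is U12-d's conclusion AT `s = 1`:
«`∃ U ∋ 1` open, `∃ B`, `√√‖u‖·|Θ(g)| ≤ B` for `g ∈ U` and every admissible unit `u` (`u·det(g)^{N−1} = disc χ_g`)».  Harish-Chandra proves it on the LIE ALGEBRA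
[HarishChandra1999, Thm. 16.2 at `γ = 1` + Cor. 6.2∕6.3: `|η|^{1∕2}·ν̂_𝒪` locally bounded on `𝔤`], i.e. in the form (12-Lie): «`∃ V ∋ 0` (in `M_N(L ⊗ L⁺_v)`), `∃ B`,
`(Π_w |disc(χ_Y)_w|_w)^{1∕4}·|Θ(y)| ≤ B` whenever `matrix(y) = c(Y) = (1+Y)(1−Y)⁻¹`, `Y ∈ V` skew (`(σY)ᵀJ = −JY`), `1 ± Y` units» — `|η_𝔤(Y)| ≍ |disc χ_Y|` and
`|D_G(c(Y))| = ‖u‖` differ by the locally constant unit `Π_w|((det(1−Y)det(1+Y))^{N−1})_w|_w` and the constant `Π_w|2^{N(N−1)}|_w` (★ `unit_mul_det_pow_eq_of_cayley`).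
This file certifies the EQUIVALENCE of the two conclusions for every `N`, every class and every `Θ` locally constant at the regular points:

* **`normalizedCharBddNearIdentity_of_lieBound`** — (12-Lie) ⇒ (12-Id): ★ `normalizedCharBddNear_central_of_lieBound'` (p855303) at `s = 1`, `z = 1` (the central
  Cayley slice covers a neighbourhood, ★ `cayleySliceCoversNhdsCentral`); the commutation clause `[s, Y] = 0` is vacuous at `s = 1`.
* **`lieBound_of_normalizedCharBddNearIdentity`** — (12-Id) ⇒ (12-Lie) (`H` invertible): slice points `c(Y)`, `Y` near `0`, lie in `U` (★ `exists_nhds_zero_slice_subset`);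
  at a REGULAR `y = c(Y)` an admissible unit exists (★ `exists_unit_rel_iff_isRegularElt`) and `‖u‖·Π_w|((det(1−Y)det(1+Y))^{N−1})_w|_w = Π_w|2^{N(N−1)}|_w·Π_w|disc(χ_Y)_w|_w`
  (★ `unitModulusChar_mul_detFactor_eq`) with the unit factor `< 2` near `0`, so the Lie weight is `≤ (2∕K)^{1∕4}·√√‖u‖`, `K = Π_w|2^{N(N−1)}|_w > 0` (char. `0`); at a
  NON-regular `y = c(Y)` the Lie weight VANISHES (`disc χ_{c(Y)}·det(1−Y)^{2(N−1)} = 2^{N(N−1)}·disc χ_Y`, ★ `discr_charpoly_cayley_mul_det_pow`, so `disc χ_Y` is not a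
  unit of `Π_w L_w`, i.e. some component is `0`).  `B_Lie = (2∕K)^{1∕4}·max B 0`.

So the dealer may host (12-Id) in EITHER currency; the Lie form is the target of the joint Lie-algebra sub-line «admissible invariant distributions on `𝔲_N` near `0`»
(rows 11∕12, p11 MEMO-ROW11 §4, this seat's SUBSIGS v1).  [HarishChandra1999AdmissibleDistributions, Thm. 16.3 p. 77, Thm. 16.2, Cor. 6.2 p. 45, §17]
[Rogawski1990, §12.7 p. 192] [PlatonovRapinchuk1994, §3.3 (Cayley parametrisation)].
HONEST LABEL: HC_CM is proved only modulo the 7 printed citations (2 remaining named inputs: hLiu418 = stmt-HodgeConjecture-24832, h413 =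
stmt-HodgeConjecture-24833) until rung 0 closes; an equivalence of two open statements — retires nothing by itself.

## References
* [HarishChandra1999AdmissibleDistributions] Harish-Chandra (notes by S. DeBacker and P. J. Sally, Jr.), *Admissible Invariant Distributions on Reductive
  p-adic Groups*, University Lecture Series 16, AMS (1999), Thm. 16.3 p. 77, Thm. 16.2, Cor. 6.2, §17.
* [Rogawski1990] J. Rogawski, *Automorphic Representations of Unitary Groups in Three Variables*, Annals of Math. Studies 123 (1990), §12.7 p. 192.
* [PlatonovRapinchuk1994] V. Platonov, A. Rapinchuk, *Algebraic Groups and Number Theory* (1994), §3.3.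
-/

set_option autoImplicit false
set_option linter.dupNamespace false   -- `Summit.HodgeConjecture.HodgeConjecture.…` (D-0017 nested layout; lakefile exemption for Summits)

noncomputable section

open NumberField IsDedekindDomain MeasureTheory Filter Topology
open scoped Matrix MatrixGroups NNReal
open Literature.NumberTheory.Rogawski1990 Literature.NumberTheory.Automorphic Literature.NumberTheory.Automorphic.UnitaryGroup
open Literature.NumberTheory.GaloisRepresentations Literature.NumberTheory.GaloisRepresentations.IsNonarchimedeanLocalField
open Summit.HodgeConjecture.HodgeConjecture.Cruxes.H413.K2E3NormalizedCharBddNearSemisimpleRegular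
open Summit.HodgeConjecture.HodgeConjecture.Cruxes.H413.K2E3NormalizedCharBddOnCayleySliceTrivialCases
open Summit.HodgeConjecture.HodgeConjecture.Cruxes.H413.K2E3NormalizedCharBddNearCentralOfLieBound
open Summit.HodgeConjecture.HodgeConjecture.Cruxes.H413.K2E3NormalizedCharBddNearCentral
open Summit.HodgeConjecture.HodgeConjecture.Cruxes.H413.K2E3CayleyCharpolyDiscr

namespace Summit.HodgeConjecture.HodgeConjecture.Cruxes.H413.K2E3NormalizedCharBddNearIdentityIffLieBound

variable (L : Type) [Field L] [NumberField L] [IsCMField L] (N : ℕ) (H : Matrix (Fin N) (Fin N) L)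
  (v : HeightOneSpectrum (𝓞 ↥(maximalRealSubfield L)))

/-- The matrix of `1 ∈ U_N(H)(L⁺_v)` is `1`. [folklore] -/
theorem val_val_one :
    (((1 : (UnitaryGroup.cmDatum L N H).Local v).val : GL (Fin N) (UnitaryGroup.LocalRing L v)).val : Matrix (Fin N) (Fin N) (UnitaryGroup.LocalRing L v)) = 1 := rfl

/-! ## §1  (12-Lie) ⇒ (12-Id) -/

set_option maxHeartbeats 1600000 in
set_option synthInstance.maxHeartbeats 400000 in
/-- **(12-Lie) ⇒ (12-Id)**: the Lie-algebra bound at the identity gives U12-d's conclusion at `s = 1` (every `N`, every class `c`, every `Θ` locally constant at the regular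
points and representing `χ_c`).  ★ `normalizedCharBddNear_central_of_lieBound'` at `s = 1`, `z = 1`. [cite: HarishChandra1999AdmissibleDistributions, Thm. 16.3 p. 77; §17]
[cite: Rogawski1990, §12.7 p. 192] -/
theorem normalizedCharBddNearIdentity_of_lieBound
    [MeasurableSpace ((UnitaryGroup.cmDatum L N H).Local v)] [BorelSpace ((UnitaryGroup.cmDatum L N H).Local v)]
    (μ : Measure ((UnitaryGroup.cmDatum L N H).Local v)) [μ.IsHaarMeasure]
    (c : IrrClass ((UnitaryGroup.cmDatum L N H).Local v)) (Θ : (UnitaryGroup.cmDatum L N H).Local v → ℂ)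
    (hloc : ∀ x : (UnitaryGroup.cmDatum L N H).Local v,
      IsRegularElt (x.val : GL (Fin N) (UnitaryGroup.LocalRing L v)) → ∀ᶠ y in 𝓝 x, Θ y = Θ x)
    (hrep : ∀ φ : (UnitaryGroup.cmDatum L N H).Local v → ℂ, IsLocSmooth φ → c.smoothTrace μ φ = ∫ x, φ x * Θ x ∂μ)
    (hLie : ∃ V : Set (Matrix (Fin N) (Fin N) (UnitaryGroup.LocalRing L v)), V ∈ 𝓝 (0 : Matrix (Fin N) (Fin N) (UnitaryGroup.LocalRing L v)) ∧
      ∃ B : ℝ, ∀ y : (UnitaryGroup.cmDatum L N H).Local v, ∀ Y ∈ V,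
        (Y.map (UnitaryGroup.conjLocal L (IsCMField.complexConj L) v))ᵀ * ((UnitaryGroup.adelicForm L N H).map (UnitaryGroup.adeleToLocal L v)) = -(((UnitaryGroup.adelicForm L N H).map (UnitaryGroup.adeleToLocal L v)) * Y) →
        IsUnit (1 - Y) → IsUnit (1 + Y) →
        ((y.val : GL (Fin N) (UnitaryGroup.LocalRing L v)).val : Matrix (Fin N) (Fin N) (UnitaryGroup.LocalRing L v)) = (1 + Y) * (1 - Y)⁻¹ →
        ((NNReal.sqrt (NNReal.sqrt (∏ w : PlacesOver L v, normAbs (w.1.adicCompletion L) ((Y.charpoly.discr) w))) : ℝ≥0) : ℝ) * ‖Θ y‖ ≤ B) :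
    ∃ U : Set ((UnitaryGroup.cmDatum L N H).Local v), IsOpen U ∧ (1 : (UnitaryGroup.cmDatum L N H).Local v) ∈ U ∧
      ∃ B : ℝ, ∀ g ∈ U, ∀ u : (UnitaryGroup.LocalRing L v)ˣ,
        (u : UnitaryGroup.LocalRing L v) *
            (((g.val : GL (Fin N) (UnitaryGroup.LocalRing L v)).val : Matrix (Fin N) (Fin N) (UnitaryGroup.LocalRing L v)).det) ^ (N - 1) =
          (((g.val : GL (Fin N) (UnitaryGroup.LocalRing L v)).val : Matrix (Fin N) (Fin N) (UnitaryGroup.LocalRing L v)).charpoly).discr →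
        ((NNReal.sqrt (NNReal.sqrt (unitModulusChar (UnitaryGroup.LocalRing L v) u)) : ℝ≥0) : ℝ) * ‖Θ g‖ ≤ B := by
  have hz : (((1 : (UnitaryGroup.cmDatum L N H).Local v).val : GL (Fin N) (UnitaryGroup.LocalRing L v)).val : Matrix (Fin N) (Fin N) (UnitaryGroup.LocalRing L v)) =
      ((1 : (UnitaryGroup.LocalRing L v)ˣ) : UnitaryGroup.LocalRing L v) • (1 : Matrix (Fin N) (Fin N) (UnitaryGroup.LocalRing L v)) := by
    rw [val_val_one, Units.val_one, one_smul]
  obtain ⟨V, hV, B, hB⟩ := hLie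
  refine normalizedCharBddNear_central_of_lieBound' L N H v μ c Θ hloc hrep 1 1 hz ⟨V, hV, B, fun y Y hY hskew _ h1 h2 hy => hB y Y hY hskew h1 h2 ?_⟩
  rw [val_val_one, one_mul] at hy
  exact hy

/-! ## §2  (12-Id) ⇒ (12-Lie) -/

set_option maxHeartbeats 1600000 in
set_option synthInstance.maxHeartbeats 400000 in
/-- **(12-Id) ⇒ (12-Lie)** (`H` invertible; every `N`, every `Θ`): slice points with `Y` near `0` lie in `U` (★ `exists_nhds_zero_slice_subset`); at a regular
`y = c(Y)` an admissible `u` exists and `Π_w|disc(χ_Y)_w|_w ≤ (2∕K)·‖u‖` once the unit factor `Π_w|((det(1−Y)det(1+Y))^{N−1})_w|_w` is `< 2` (★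
`unitModulusChar_mul_detFactor_eq`, `K = Π_w|2^{N(N−1)}|_w > 0`); at a non-regular `y = c(Y)` the Lie weight is `0` (★ `discr_charpoly_cayley_mul_det_pow`).
[cite: HarishChandra1999AdmissibleDistributions, Thm. 16.3 p. 77; §17] [cite: PlatonovRapinchuk1994, §3.3] -/
theorem lieBound_of_normalizedCharBddNearIdentity (hHd : H.det ≠ 0) (Θ : (UnitaryGroup.cmDatum L N H).Local v → ℂ)
    (hId : ∃ U : Set ((UnitaryGroup.cmDatum L N H).Local v), IsOpen U ∧ (1 : (UnitaryGroup.cmDatum L N H).Local v) ∈ U ∧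
      ∃ B : ℝ, ∀ g ∈ U, ∀ u : (UnitaryGroup.LocalRing L v)ˣ,
        (u : UnitaryGroup.LocalRing L v) *
            (((g.val : GL (Fin N) (UnitaryGroup.LocalRing L v)).val : Matrix (Fin N) (Fin N) (UnitaryGroup.LocalRing L v)).det) ^ (N - 1) =
          (((g.val : GL (Fin N) (UnitaryGroup.LocalRing L v)).val : Matrix (Fin N) (Fin N) (UnitaryGroup.LocalRing L v)).charpoly).discr →
        ((NNReal.sqrt (NNReal.sqrt (unitModulusChar (UnitaryGroup.LocalRing L v) u)) : ℝ≥0) : ℝ) * ‖Θ g‖ ≤ B) :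
    ∃ V : Set (Matrix (Fin N) (Fin N) (UnitaryGroup.LocalRing L v)), V ∈ 𝓝 (0 : Matrix (Fin N) (Fin N) (UnitaryGroup.LocalRing L v)) ∧
      ∃ B : ℝ, ∀ y : (UnitaryGroup.cmDatum L N H).Local v, ∀ Y ∈ V,
        (Y.map (UnitaryGroup.conjLocal L (IsCMField.complexConj L) v))ᵀ * ((UnitaryGroup.adelicForm L N H).map (UnitaryGroup.adeleToLocal L v)) = -(((UnitaryGroup.adelicForm L N H).map (UnitaryGroup.adeleToLocal L v)) * Y) →
        IsUnit (1 - Y) → IsUnit (1 + Y) →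
        ((y.val : GL (Fin N) (UnitaryGroup.LocalRing L v)).val : Matrix (Fin N) (Fin N) (UnitaryGroup.LocalRing L v)) = (1 + Y) * (1 - Y)⁻¹ →
        ((NNReal.sqrt (NNReal.sqrt (∏ w : PlacesOver L v, normAbs (w.1.adicCompletion L) ((Y.charpoly.discr) w))) : ℝ≥0) : ℝ) * ‖Θ y‖ ≤ B := by
  obtain ⟨U, hUo, h1U, B, hB⟩ := hId
  -- slice points near `Y = 0` lie in `U`
  obtain ⟨V₁, hV₁, hV₁U⟩ := exists_nhds_zero_slice_subset L N H v hHd (1 : (UnitaryGroup.cmDatum L N H).Local v) (hUo.mem_nhds h1U)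
  -- the unit factor and its upper bound `2` near `0`
  set Mf : Matrix (Fin N) (Fin N) (UnitaryGroup.LocalRing L v) → ℝ≥0 := fun Y =>
    ∏ w : PlacesOver L v, normAbs (w.1.adicCompletion L) ((((1 - Y).det * (1 + Y).det) ^ (N - 1)) w) with hMf
  have hMc : Continuous Mf := continuous_detFactor L N v
  have hM0 : Mf 0 = 1 := detFactor_zero L N v
  have hV₂ : Mf ⁻¹' Set.Iio 2 ∈ 𝓝 (0 : Matrix (Fin N) (Fin N) (UnitaryGroup.LocalRing L v)) := by
    refine (hMc.isOpen_preimage _ isOpen_Iio).mem_nhds ?_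
    rw [Set.mem_preimage, hM0, Set.mem_Iio]
    exact one_lt_two
  -- the constant `K = Π_w |2^{N(N−1)}|_w > 0`
  set K : ℝ≥0 := ∏ w : PlacesOver L v, normAbs (w.1.adicCompletion L) (((2 : UnitaryGroup.LocalRing L v) ^ (N * (N - 1))) w) with hK
  have h2w : ∀ w : PlacesOver L v, ((2 : UnitaryGroup.LocalRing L v) ^ (N * (N - 1))) w = (2 : w.1.adicCompletion L) ^ (N * (N - 1)) := fun w => rfl
  have h2ne : ∀ w : PlacesOver L v, (2 : w.1.adicCompletion L) ^ (N * (N - 1)) ≠ 0 := by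
    intro w
    haveI : CharZero (w.1.adicCompletion L) := charZero_of_injective_algebraMap (algebraMap L (w.1.adicCompletion L)).injective
    exact pow_ne_zero _ two_ne_zero
  have hKpos : 0 < K := by
    refine Finset.prod_pos fun w _ => pos_iff_ne_zero.2 ?_
    rw [h2w w]
    exact (map_ne_zero (normAbs (w.1.adicCompletion L))).2 (h2ne w)
  have h2unit : IsUnit ((2 : UnitaryGroup.LocalRing L v) ^ (N * (N - 1))) := by
    refine Pi.isUnit_iff.2 fun w => ?_
    rw [h2w w]
    exact isUnit_iff_ne_zero.2 (h2ne w)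
  refine ⟨V₁ ∩ Mf ⁻¹' Set.Iio 2, Filter.inter_mem hV₁ hV₂, ((NNReal.sqrt (NNReal.sqrt (2 / K)) : ℝ≥0) : ℝ) * max B 0, ?_⟩
  intro y Y hYV hskew h1 h2 hy
  have hYM : Mf Y < 2 := hYV.2
  have hyU : y ∈ U := hV₁U y Y hYV.1 (by rw [val_val_one, one_mul]; exact hy)
  have h1det : IsUnit (1 - Y).det := (Matrix.isUnit_iff_isUnit_det _).1 h1
  set D : ℝ≥0 := ∏ w : PlacesOver L v, normAbs (w.1.adicCompletion L) ((Y.charpoly.discr) w) with hD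
  have hB0 : 0 ≤ ((NNReal.sqrt (NNReal.sqrt (2 / K)) : ℝ≥0) : ℝ) * max B 0 := mul_nonneg (NNReal.coe_nonneg _) (le_max_right _ _)
  by_cases hreg : IsRegularElt (y.val : GL (Fin N) (UnitaryGroup.LocalRing L v))
  · -- an admissible unit at `y`, and the comparison of the two weights
    obtain ⟨u, hu⟩ := (exists_unit_rel_iff_isRegularElt L N H v y).2 hreg
    have hb : ((NNReal.sqrt (NNReal.sqrt (unitModulusChar (UnitaryGroup.LocalRing L v) u)) : ℝ≥0) : ℝ) * ‖Θ y‖ ≤ max B 0 :=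
      (hB y hyU u hu).trans (le_max_left _ _)
    have hu' : (u : UnitaryGroup.LocalRing L v) * (((1 : (UnitaryGroup.LocalRing L v)ˣ) : UnitaryGroup.LocalRing L v) • ((1 + Y) * (1 - Y)⁻¹)).det ^ (N - 1) =
        ((((1 : (UnitaryGroup.LocalRing L v)ˣ) : UnitaryGroup.LocalRing L v) • ((1 + Y) * (1 - Y)⁻¹)).charpoly).discr := by
      rw [Units.val_one, one_smul, ← hy]
      exact hu
    have hmod := unitModulusChar_mul_detFactor_eq L N v Y h1 1 u hu'
    -- `K * D = ‖u‖ * Mf Y ≤ 2 * ‖u‖`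
    have hle : D ≤ 2 / K * unitModulusChar (UnitaryGroup.LocalRing L v) u := by
      have h2 : K * D ≤ unitModulusChar (UnitaryGroup.LocalRing L v) u * 2 := by
        rw [← hmod]
        exact mul_le_mul_of_nonneg_left hYM.le (zero_le)
      rw [div_mul_eq_mul_div, le_div_iff₀ hKpos, mul_comm D K, mul_comm 2]
      exact h2
    have hsqrt : NNReal.sqrt (NNReal.sqrt D) ≤ NNReal.sqrt (NNReal.sqrt (2 / K)) * NNReal.sqrt (NNReal.sqrt (unitModulusChar (UnitaryGroup.LocalRing L v) u)) := by
      rw [← NNReal.sqrt_mul, ← NNReal.sqrt_mul]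
      exact NNReal.sqrt_le_sqrt.2 (NNReal.sqrt_le_sqrt.2 hle)
    calc ((NNReal.sqrt (NNReal.sqrt D) : ℝ≥0) : ℝ) * ‖Θ y‖
        ≤ (((NNReal.sqrt (NNReal.sqrt (2 / K)) * NNReal.sqrt (NNReal.sqrt (unitModulusChar (UnitaryGroup.LocalRing L v) u)) : ℝ≥0)) : ℝ) * ‖Θ y‖ :=
          mul_le_mul_of_nonneg_right (NNReal.coe_le_coe.2 hsqrt) (norm_nonneg _)
      _ = ((NNReal.sqrt (NNReal.sqrt (2 / K)) : ℝ≥0) : ℝ) * ((((NNReal.sqrt (NNReal.sqrt (unitModulusChar (UnitaryGroup.LocalRing L v) u))) : ℝ≥0) : ℝ) * ‖Θ y‖) := by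
          rw [NNReal.coe_mul, mul_assoc]
      _ ≤ ((NNReal.sqrt (NNReal.sqrt (2 / K)) : ℝ≥0) : ℝ) * max B 0 := mul_le_mul_of_nonneg_left hb (NNReal.coe_nonneg _)
  · -- `y = c(Y)` not regular ⇒ `disc χ_Y` is not a unit of `Π_w L_w` ⇒ the Lie weight vanishes
    have hnot : ¬ IsUnit Y.charpoly.discr := by
      intro hdY
      apply hreg
      rw [isRegularElt_iff_isUnit_discr, hy]
      have hid := discr_charpoly_cayley_mul_det_pow Y h1det
      have hr : IsUnit (((1 + Y) * (1 - Y)⁻¹).charpoly.discr * (1 - Y).det ^ (2 * (N - 1))) := by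
        rw [hid]
        exact h2unit.mul hdY
      exact isUnit_of_mul_isUnit_left hr
    have hD0 : D = 0 := by
      rw [Pi.isUnit_iff, not_forall] at hnot
      obtain ⟨w, hw⟩ := hnot
      rw [isUnit_iff_ne_zero, not_not] at hw
      exact Finset.prod_eq_zero (Finset.mem_univ w) (by rw [hw, map_zero])
    rw [hD0, NNReal.sqrt_zero, NNReal.sqrt_zero, NNReal.coe_zero, zero_mul]
    exact hB0

end Summit.HodgeConjecture.HodgeConjecture.Cruxes.H413.K2E3NormalizedCharBddNearIdentityIffLieBound

end
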